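import Mathlib.LinearAlgebra.TensorProduct.Associator
import Mathlib.LinearAlgebra.TensorProduct.Map
import Mathlib.LinearAlgebra.Basis.VectorSpace
import HarnessLib

/-!
# The Künneth formula in degree `1` over a field: injectivity of the restriction to the slices

Let `k` be a field and let `C⁰ → C¹`, `D⁰ → D¹` be the beginnings of two cochain complexes of
`k`-vector spaces (`d_C`, `d_D`), each with a "unit" `1_C ∈ C⁰`, `1_D ∈ D⁰` killed by the
differential and an "evaluation" functional `φ : C⁰ → k`, `ψ : D⁰ → k` with `φ(1_C) = ψ(1_D) = 1`
such that `H⁰` is spanned by the unit in the strong form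
`d_C z = 0 ∧ φ z = 0 ⇒ z = 0` (and likewise for `D`). A `1`-cochain of the tensor product double
complex is a pair `(h, v) ∈ (C¹ ⊗ D⁰) ⊕ (C⁰ ⊗ D¹)`; it is *mixed-closed* if
`(1 ⊗ d_D) h = (d_C ⊗ 1) v` in `C¹ ⊗ D¹`. The degree-`1` Künneth statement we record
(`exists_tensor_primitive_of_slices`) is: **if the slices `(φ ⊗ 1) v ∈ D¹` and `(1 ⊗ ψ) h ∈ C¹`
are coboundaries, then `(h, v) = ((d_C ⊗ 1) g, (1 ⊗ d_D) g)` for some `g ∈ C⁰ ⊗ D⁰`.**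

This is the linear algebra behind the injectivity of
`H¹(X ×_k Y, 𝒪) → H¹({x} × Y, 𝒪) ⊕ H¹(X × {y}, 𝒪)` for proper geometrically integral `X`, `Y`
with rational points `x`, `y` (Görtz–Wedhorn II, proof of Thm. 24.73, via the Künneth formula
Cor. 22.110: `H¹(X × Y) = H⁰(X) ⊗ H¹(Y) ⊕ H¹(X) ⊗ H⁰(Y)` and `H⁰ = k`; the algebraic Künneth
formula for complexes of modules is Prop. F.95), taken on the Čech complexes `C`, `D` of finite
affine coverings of `X`, `Y` with `φ`, `ψ` the evaluations at `x`, `y`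
(`Literature/AlgebraicGeometry/Motives/KunnethH1ProductCoverProofs`). The proof is
elementary: with the projections `π_C = id - φ(·) 1_C` onto `ker φ` and a `k`-linear left
inverse `λ_C` of `d_C` on `ker φ` (which is injective there by the `H⁰` hypothesis; Mathlib
`LinearMap.exists_leftInverse_of_injective`), the corrected cochains
`v₂ = v - 1_C ⊗ d_D e = (π_C ⊗ 1) v`, `h₂ = h - d_C f ⊗ 1_D = (1 ⊗ π_D) h` satisfy
`(λ_C ⊗ 1)(d_C ⊗ 1) v₂ = v₂`, `(1 ⊗ λ_D)(1 ⊗ d_D) h₂ = h₂`, whence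
`g = f ⊗ 1_D + 1_C ⊗ e + (1 ⊗ λ_D) v₂` works.

Mathlib searched (pin): `LinearMap.rTensor`, `LinearMap.lTensor`, `LinearMap.rTensor_comp_lTensor`,
`LinearMap.lTensor_comp_rTensor`, `TensorProduct.lid`, `TensorProduct.rid`,
`LinearMap.exists_leftInverse_of_injective` (used); Mathlib has the algebraic Künneth formula for
neither chain complexes nor double complexes in a form usable here.

## References

* U. Görtz, T. Wedhorn, *Algebraic Geometry II: Cohomology of Schemes*, Springer Spektrum (2023),
  doi:10.1007/978-3-658-43031-3: Cor. 22.110; Thm. 24.73 and its proof; Prop. F.95 (Künneth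
  formula for complexes of modules) (read via the held copy, text chunks 0399, 0550, 0996).
  [GortzWedhorn2023]
-/

namespace Literature.Algebra.Homology

open TensorProduct

variable {k : Type*} [Field k]
variable {C0 C1 D0 D1 : Type*} [AddCommGroup C0] [Module k C0] [AddCommGroup C1] [Module k C1]
  [AddCommGroup D0] [Module k D0] [AddCommGroup D1] [Module k D1]

variable (k) in
/-- The left slice map `φ ⊗ 1 : C⁰ ⊗ N → k ⊗ N = N` of a functional `φ : C⁰ → k`
(`z ⊗ w ↦ φ(z) w`). [folklore] -/
noncomputable def contractLeft (φ : C0 →ₗ[k] k) (N : Type*) [AddCommGroup N] [Module k N] :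
    C0 ⊗[k] N →ₗ[k] N :=
  (TensorProduct.lid k N).toLinearMap ∘ₗ φ.rTensor N

variable (k) in
/-- The right slice map `1 ⊗ ψ : M ⊗ D⁰ → M ⊗ k = M` of a functional `ψ : D⁰ → k`
(`u ⊗ w ↦ ψ(w) u`). [folklore] -/
noncomputable def contractRight (ψ : D0 →ₗ[k] k) (M : Type*) [AddCommGroup M] [Module k M] :
    M ⊗[k] D0 →ₗ[k] M :=
  (TensorProduct.rid k M).toLinearMap ∘ₗ ψ.lTensor M

/-- `(φ ⊗ 1)(z ⊗ w) = φ(z) w`. [folklore] -/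
@[simp]
theorem contractLeft_tmul (φ : C0 →ₗ[k] k) {N : Type*} [AddCommGroup N] [Module k N] (z : C0)
    (w : N) : contractLeft k φ N (z ⊗ₜ w) = φ z • w := by
  simp [contractLeft]

/-- `(1 ⊗ ψ)(u ⊗ w) = ψ(w) u`. [folklore] -/
@[simp]
theorem contractRight_tmul (ψ : D0 →ₗ[k] k) {M : Type*} [AddCommGroup M] [Module k M] (u : M)
    (w : D0) : contractRight k ψ M (u ⊗ₜ w) = ψ w • u := by
  simp [contractRight]

/-- A `k`-linear map injective on the kernel of a functional `φ` has a `k`-linear left inverse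
there. [folklore] -/
theorem exists_leftInverse_on_ker (d : C0 →ₗ[k] C1) (φ : C0 →ₗ[k] k)
    (hC : ∀ z, d z = 0 → φ z = 0 → z = 0) :
    ∃ l : C1 →ₗ[k] C0, ∀ z, φ z = 0 → l (d z) = z := by
  set K := LinearMap.ker φ
  have hinj : LinearMap.ker (d ∘ₗ K.subtype) = ⊥ := by
    rw [LinearMap.ker_eq_bot']
    rintro ⟨z, hz⟩ hz0
    exact Subtype.ext (hC z hz0 hz)
  obtain ⟨g, hg⟩ := LinearMap.exists_leftInverse_of_injective (d ∘ₗ K.subtype) hinj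
  refine ⟨K.subtype ∘ₗ g, fun z hz => ?_⟩
  have h1 := LinearMap.congr_fun hg ⟨z, hz⟩
  simp only [LinearMap.coe_comp, Function.comp_apply, Submodule.coe_subtype,
    LinearMap.id_coe, id_eq] at h1
  simp only [LinearMap.coe_comp, Function.comp_apply, Submodule.coe_subtype, h1]

/-- **Künneth in degree `1` over a field, injectivity on the slices.** Let `d_C : C⁰ → C¹`,
`d_D : D⁰ → D¹` be `k`-linear, `1_C ∈ C⁰`, `1_D ∈ D⁰` with `d_C 1_C = 0`, `d_D 1_D = 0`,
`φ : C⁰ → k`, `ψ : D⁰ → k` with `φ 1_C = 1 = ψ 1_D` and `H⁰ = k · 1` in the form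
`d z = 0 ∧ φ z = 0 ⇒ z = 0`. If `h ∈ C¹ ⊗ D⁰`, `v ∈ C⁰ ⊗ D¹` satisfy the mixed cocycle identity
`(1 ⊗ d_D) h = (d_C ⊗ 1) v` and the slices `(φ ⊗ 1) v`, `(1 ⊗ ψ) h` are coboundaries, then
`h = (d_C ⊗ 1) g` and `v = (1 ⊗ d_D) g` for some `g ∈ C⁰ ⊗ D⁰` (the degree-`1` case of the
Künneth formula `H¹(C ⊗ D) = H⁰(C) ⊗ H¹(D) ⊕ H¹(C) ⊗ H⁰(D)` with `H⁰ = k`, Prop. F.95 (2), as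
used in Görtz–Wedhorn II, proof of Thm. 24.73 with Cor. 22.110).
[cite: GortzWedhorn2023, Prop. F.95 (2) with Cor. 22.110 and Thm. 24.73 proof] -/
theorem exists_tensor_primitive_of_slices (dC : C0 →ₗ[k] C1) (dD : D0 →ₗ[k] D1) (oneC : C0)
    (oneD : D0) (φ : C0 →ₗ[k] k) (ψ : D0 →ₗ[k] k) (hdC : dC oneC = 0) (hdD : dD oneD = 0)
    (hφ : φ oneC = 1) (hψ : ψ oneD = 1) (hC : ∀ z, dC z = 0 → φ z = 0 → z = 0)
    (hD : ∀ w, dD w = 0 → ψ w = 0 → w = 0) (h : C1 ⊗[k] D0) (v : C0 ⊗[k] D1)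
    (hmix : dD.lTensor C1 h = dC.rTensor D1 v) (hv : ∃ e : D0, contractLeft k φ D1 v = dD e)
    (hh : ∃ f : C0, contractRight k ψ C1 h = dC f) :
    ∃ g : C0 ⊗[k] D0, dC.rTensor D0 g = h ∧ dD.lTensor C0 g = v := by
  obtain ⟨e, he⟩ := hv
  obtain ⟨f, hf⟩ := hh
  obtain ⟨lC, hlC⟩ := exists_leftInverse_on_ker dC φ hC
  obtain ⟨lD, hlD⟩ := exists_leftInverse_on_ker dD ψ hD
  -- the projections onto `ker φ`, `ker ψ`
  set πC : C0 →ₗ[k] C0 := LinearMap.id - φ.smulRight oneC with hπC_def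
  set πD : D0 →ₗ[k] D0 := LinearMap.id - ψ.smulRight oneD with hπD_def
  have hπC : ∀ z, πC z = z - φ z • oneC := fun z => rfl
  have hπD : ∀ w, πD w = w - ψ w • oneD := fun w => rfl
  have hφπ : ∀ z, φ (πC z) = 0 := fun z => by
    rw [hπC, map_sub, map_smul, hφ, smul_eq_mul, mul_one, sub_self]
  have hψπ : ∀ w, ψ (πD w) = 0 := fun w => by
    rw [hπD, map_sub, map_smul, hψ, smul_eq_mul, mul_one, sub_self]
  have hlCπ : (lC ∘ₗ dC) ∘ₗ πC = πC := LinearMap.ext fun z => hlC _ (hφπ z)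
  have hlDπ : (lD ∘ₗ dD) ∘ₗ πD = πD := LinearMap.ext fun w => hlD _ (hψπ w)
  -- the corrected cochains
  set v₂ : C0 ⊗[k] D1 := v - oneC ⊗ₜ dD e with hv₂_def
  set h₂ : C1 ⊗[k] D0 := h - dC f ⊗ₜ oneD with hh₂_def
  have hv₂ : πC.rTensor D1 v = v₂ := by
    have key : πC.rTensor D1 =
        LinearMap.id - (TensorProduct.mk k C0 D1 oneC) ∘ₗ contractLeft k φ D1 := by
      apply TensorProduct.ext'
      intro z w
      simp only [LinearMap.rTensor_tmul, hπC, sub_tmul, LinearMap.sub_apply, LinearMap.id_coe,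
        id_eq, LinearMap.coe_comp, Function.comp_apply, contractLeft_tmul, map_smul,
        TensorProduct.mk_apply, smul_tmul']
    rw [key, LinearMap.sub_apply, LinearMap.id_apply, LinearMap.comp_apply, he,
      TensorProduct.mk_apply]
  have hh₂ : πD.lTensor C1 h = h₂ := by
    have key : πD.lTensor C1 =
        LinearMap.id - ((TensorProduct.mk k C1 D0).flip oneD) ∘ₗ contractRight k ψ C1 := by
      apply TensorProduct.ext'
      intro u w
      simp only [LinearMap.lTensor_tmul, hπD, tmul_sub, LinearMap.sub_apply, LinearMap.id_coe,
        id_eq, LinearMap.coe_comp, Function.comp_apply, contractRight_tmul, map_smul,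
        LinearMap.flip_apply, TensorProduct.mk_apply, tmul_smul]
    rw [key, LinearMap.sub_apply, LinearMap.id_apply, LinearMap.comp_apply, hf,
      LinearMap.flip_apply, TensorProduct.mk_apply]
  -- both have the same image `m` in `C¹ ⊗ D¹`
  have hm : dC.rTensor D1 v₂ = dD.lTensor C1 h₂ := by
    rw [hv₂_def, hh₂_def, map_sub, map_sub, LinearMap.rTensor_tmul, LinearMap.lTensor_tmul, hdC,
      hdD, zero_tmul, tmul_zero, sub_zero, sub_zero, hmix]
  -- `(λ_C ⊗ 1)(d_C ⊗ 1) v₂ = v₂` and `(1 ⊗ λ_D)(1 ⊗ d_D) h₂ = h₂`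
  have hv₂' : lC.rTensor D1 (dC.rTensor D1 v₂) = v₂ := by
    rw [← hv₂, ← LinearMap.comp_apply, ← LinearMap.comp_apply, ← LinearMap.rTensor_comp,
      ← LinearMap.rTensor_comp, hlCπ]
  have hh₂' : lD.lTensor C1 (dD.lTensor C1 h₂) = h₂ := by
    rw [← hh₂, ← LinearMap.comp_apply, ← LinearMap.comp_apply, ← LinearMap.lTensor_comp,
      ← LinearMap.lTensor_comp, hlDπ]
  -- the primitive of the corrected pair
  set g₂ : C0 ⊗[k] D0 := lD.lTensor C0 v₂ with hg₂_def
  set g₂' : C0 ⊗[k] D0 := lC.rTensor D0 h₂ with hg₂'_def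
  have comm1 : dC.rTensor D0 ∘ₗ lD.lTensor C0 = lD.lTensor C1 ∘ₗ dC.rTensor D1 := by
    rw [LinearMap.rTensor_comp_lTensor, LinearMap.lTensor_comp_rTensor]
  have comm2 : dD.lTensor C0 ∘ₗ lC.rTensor D0 = lC.rTensor D1 ∘ₗ dD.lTensor C1 := by
    rw [LinearMap.lTensor_comp_rTensor, LinearMap.rTensor_comp_lTensor]
  have comm3 : lD.lTensor C0 ∘ₗ lC.rTensor D1 = lC.rTensor D0 ∘ₗ lD.lTensor C1 := by
    rw [LinearMap.lTensor_comp_rTensor, LinearMap.rTensor_comp_lTensor]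
  have hdg₂ : dC.rTensor D0 g₂ = h₂ := by
    rw [hg₂_def, ← LinearMap.comp_apply, comm1, LinearMap.comp_apply, hm, hh₂']
  have hdg₂' : dD.lTensor C0 g₂' = v₂ := by
    rw [hg₂'_def, ← LinearMap.comp_apply, comm2, LinearMap.comp_apply, ← hm, hv₂']
  have hgg : g₂ = g₂' := by
    rw [hg₂_def, ← hv₂', hm, ← LinearMap.comp_apply, comm3, LinearMap.comp_apply, hh₂']
  refine ⟨f ⊗ₜ oneD + oneC ⊗ₜ e + g₂, ?_, ?_⟩
  · rw [map_add, map_add, LinearMap.rTensor_tmul, LinearMap.rTensor_tmul, hdC, zero_tmul,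
      add_zero, hdg₂, hh₂_def, add_sub_cancel]
  · rw [map_add, map_add, LinearMap.lTensor_tmul, LinearMap.lTensor_tmul, hdD, tmul_zero,
      zero_add, hgg, hdg₂', hv₂_def, add_sub_cancel]

end Literature.Algebra.Homology
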